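import Summits.Ventures.HodgeRepro2.UnitaryReflection
import Summits.Ventures.HodgeRepro2.LevelNormalizer
import Summits.Ventures.HodgeRepro2.SelfAdjointHeckeInvolution

/-!
# The sign involution `diag(−1, 1, −1)` of the antidiagonal form `antidiag(1, u, 1)`

For the hermitian form `H_u = antidiag(1, u, 1)` (`u ∈ K⁺`, `u ≠ 0`) the unitary reflection in the
middle basis vector `e₂` is `r = diag(1, −1, 1)`, so `δ := −r = diag(−1, 1, −1)` is an involution of
`SU(H_u)(K)`.  It stabilises every *coordinate lattice* (a `ℤ`-submodule of `K³` closed under the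
coordinate projections, e.g. `𝔞₁ ⊕ 𝔞₂ ⊕ 𝔞₃`), hence normalises every `Γ_N` of such a lattice
(`LevelNormalizer.lean`): the Hecke operator `T_δ` on the weight-`k` forms for `Γ_N` is the single
slash `f ↦ f ∥_k δ`, an Atkin–Lehner-type involution.  Being an involution `≠ 1`, `δ` lies outside
every torsion-free `S'` and satisfies `δ⁻¹ ∈ S' δ S'` (`SelfAdjointHeckeInvolution.lean`).
-/

namespace Summit.Ventures.HodgeRepro2.ShimuraData

open Matrix

variable {K : Type*} [Field K] [NumberField K] [NumberField.IsCMField K]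

/-- The antidiagonal hermitian form `antidiag(1, u, 1)`. -/
def antidiagForm (u : K) : Matrix (Fin 3) (Fin 3) K := !![0, 0, 1; 0, u, 0; 1, 0, 0]

/-- `antidiag(1, u, 1)` is a hermitian form when `u` is real (`ρ u = u`). -/
theorem isHermitianForm_antidiagForm {u : K} (hu : ρ K u = u) :
    IsHermitianForm K (antidiagForm u) := by
  unfold IsHermitianForm conjTransposeK antidiagForm
  ext i j
  fin_cases i <;> fin_cases j <;> simp [hu]

/-- `e₂* H_u e₂ = u`. -/
theorem hermDot_antidiagForm_single_one (u : K) :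
    hermDot (antidiagForm u) (Pi.single 1 1) (Pi.single 1 1) = u := by
  rw [hermDot_single_single]
  simp [antidiagForm]

omit [NumberField K] [NumberField.IsCMField K] in
/-- The sign involution `diag(−1, 1, −1)`. -/
def signInvolution : Matrix (Fin 3) (Fin 3) K := diagonal ![-1, 1, -1]

omit [NumberField K] [NumberField.IsCMField K] in
/-- `diag(−1, 1, −1)² = 1`. -/
theorem signInvolution_mul_self : signInvolution * signInvolution = (1 : Matrix (Fin 3) (Fin 3) K) := by
  unfold signInvolution
  rw [diagonal_mul_diagonal]
  ext i j
  fin_cases i <;> fin_cases j <;> simp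

omit [NumberField K] [NumberField.IsCMField K] in
/-- `diag(−1, 1, −1)` as an element of `GL₃(K)`. -/
def signInvolutionGL : GL (Fin 3) K :=
  ⟨signInvolution, signInvolution, signInvolution_mul_self, signInvolution_mul_self⟩

omit [NumberField K] [NumberField.IsCMField K] in
/-- The underlying matrix of `signInvolutionGL`. -/
@[simp] theorem coe_signInvolutionGL :
    ((signInvolutionGL : GL (Fin 3) K) : Matrix (Fin 3) (Fin 3) K) = signInvolution :=
  rfl

omit [NumberField K] [NumberField.IsCMField K] in
/-- `signInvolutionGL * signInvolutionGL = 1`. -/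
theorem signInvolutionGL_mul_self : (signInvolutionGL : GL (Fin 3) K) * signInvolutionGL = 1 :=
  Units.ext signInvolution_mul_self

omit [NumberField.IsCMField K] in
/-- `signInvolutionGL ≠ 1` (characteristic `0`: `−1 ≠ 1`). -/
theorem signInvolutionGL_ne_one : (signInvolutionGL : GL (Fin 3) K) ≠ 1 := by
  intro h
  have h00 := congrArg (fun g : GL (Fin 3) K => (g : Matrix (Fin 3) (Fin 3) K) 0 0) h
  simp only [coe_signInvolutionGL, Units.val_one, one_apply_eq] at h00
  have h2 : (-1 : K) = 1 := by simpa [signInvolution] using h00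
  norm_num at h2

/-- The unitary reflection of `antidiag(1, u, 1)` in `e₂` is `diag(1, −1, 1)`. -/
theorem reflection_antidiagForm_single_one {u : K} (hu : u ≠ 0) :
    reflection (antidiagForm u) (Pi.single 1 1) = diagonal ![1, -1, 1] := by
  have hs : (Pi.single (1 : Fin 3) (1 : K)) = ![0, 1, 0] := by
    ext i; fin_cases i <;> simp
  have hrow : conjRow (antidiagForm u) (Pi.single 1 1) = ![0, u, 0] := by
    rw [hs]
    ext j
    fin_cases j <;> simp [conjRow, antidiagForm, vecMul, dotProduct, Fin.sum_univ_three]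
  unfold reflection
  rw [hermDot_antidiagForm_single_one, hrow, hs]
  ext i j
  fin_cases i <;> fin_cases j <;> simp [div_mul_cancel₀ _ hu]
  norm_num

/-- `diag(−1, 1, −1) = −r_{e₂}` for the antidiagonal form. -/
theorem signInvolution_eq_neg_reflection {u : K} (hu : u ≠ 0) :
    (signInvolution : Matrix (Fin 3) (Fin 3) K) =
      -(reflection (antidiagForm u) (Pi.single 1 1)) := by
  rw [reflection_antidiagForm_single_one hu]
  unfold signInvolution
  rw [diagonal_neg]
  congr 1
  ext i
  fin_cases i <;> simp

/-- `diag(−1, 1, −1) ∈ SU(antidiag(1, u, 1))(K)` for real `u ≠ 0`. -/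
theorem signInvolutionGL_mem_specialUnitaryGroup {u : K} (hu : ρ K u = u) (hu0 : u ≠ 0) :
    (signInvolutionGL : GL (Fin 3) K) ∈ specialUnitaryGroup K (antidiagForm u) := by
  have hc : hermDot (antidiagForm u) (Pi.single 1 1) (Pi.single 1 1) ≠ 0 := by
    rw [hermDot_antidiagForm_single_one]; exact hu0
  have h : (signInvolutionGL : GL (Fin 3) K) = -reflectionGL (antidiagForm u) (Pi.single 1 1) hc := by
    apply Units.ext
    rw [Units.val_neg, coe_reflectionGL, coe_signInvolutionGL]
    exact signInvolution_eq_neg_reflection hu0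
  rw [h]
  exact neg_reflectionGL_mem_specialUnitaryGroup (isHermitianForm_antidiagForm hu) hc

omit [NumberField K] [NumberField.IsCMField K] in
/-- A coordinate lattice (closed under the coordinate projections) is stable under
`diag(−1, 1, −1)` in the row-vector action. -/
theorem vecMul_signInvolution_mem {𝔪 : Submodule ℤ (Fin 3 → K)}
    (hcoord : ∀ x ∈ 𝔪, ∀ i, Pi.single i (x i) ∈ 𝔪) {x : Fin 3 → K} (hx : x ∈ 𝔪) :
    x ᵥ* (signInvolution : Matrix (Fin 3) (Fin 3) K) ∈ 𝔪 := by
  have hrep : x ᵥ* (signInvolution : Matrix (Fin 3) (Fin 3) K) =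
      ∑ j, Pi.single j (x j * ![(-1 : K), 1, -1] j) := by
    rw [Finset.univ_sum_single]
    funext j
    unfold signInvolution
    rw [vecMul_diagonal]
  rw [hrep]
  refine Submodule.sum_mem _ fun j _ => ?_
  fin_cases j
  · simpa [Pi.single_neg] using 𝔪.neg_mem (hcoord x hx 0)
  · simpa using hcoord x hx 1
  · simpa [Pi.single_neg] using 𝔪.neg_mem (hcoord x hx 2)

omit [NumberField K] [NumberField.IsCMField K] in
/-- `diag(−1, 1, −1)` stabilises every coordinate lattice. -/
theorem stabilizesLattice_signInvolutionGL {𝔪 : Submodule ℤ (Fin 3 → K)}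
    (hcoord : ∀ x ∈ 𝔪, ∀ i, Pi.single i (x i) ∈ 𝔪) :
    StabilizesLattice 𝔪 (signInvolutionGL : GL (Fin 3) K) :=
  StabilizesLattice.of_sq_eq_one signInvolutionGL_mul_self fun _ hx =>
    vecMul_signInvolution_mem hcoord hx

/-- **The Atkin–Lehner involution of the record's form**: for `H_u = antidiag(1, u, 1)` and a
coordinate lattice `𝔪`, `δ = diag(−1, 1, −1)` normalises every `Γ_N`, `T_δ` is the slash by `δ`,
and `T_δ ∘ T_δ = id` on the weight-`k` forms for `Γ_N`. -/
theorem hecke_signInvolution_antidiagForm {τ₁ : K →+* ℂ} {u : K} (hu : ρ K u = u) (hu0 : u ≠ 0)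
    {Q : Matrix (Fin 3) (Fin 3) ℂ} (hQ : IsFrame K τ₁ (antidiagForm u) Q)
    {𝔪 : Submodule ℤ (Fin 3 → K)} (hcoord : ∀ x ∈ 𝔪, ∀ i, Pi.single i (x i) ∈ 𝔪) {N : ℕ}
    [Fintype (shimuraLevelSubgroup K (antidiagForm u) 𝔪 N ⧸
      (heckeSubgroup (shimuraLevelSubgroup K (antidiagForm u) 𝔪 N) signInvolutionGL).subgroupOf
        (shimuraLevelSubgroup K (antidiagForm u) 𝔪 N))]
    {k : ℕ} {f : (Fin 2 → ℂ) → ℂ}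
    (hf : IsWeightFor τ₁ Q (shimuraLevelSubgroup K (antidiagForm u) 𝔪 N) k f)
    {z : Fin 2 → ℂ} (hz : z ∈ ball₂) :
    hecke (shimuraLevelSubgroup K (antidiagForm u) 𝔪 N) signInvolutionGL τ₁ Q k f z =
        slash k (realEmbedding K τ₁ Q signInvolutionGL) f z ∧
      hecke (shimuraLevelSubgroup K (antidiagForm u) 𝔪 N) signInvolutionGL τ₁ Q k
        (hecke (shimuraLevelSubgroup K (antidiagForm u) 𝔪 N) signInvolutionGL τ₁ Q k f) z = f z := by
  have hδ : (signInvolutionGL : GL (Fin 3) K) ∈ unitaryGroup K (antidiagForm u) :=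
    (Subgroup.mem_inf.mp (signInvolutionGL_mem_specialUnitaryGroup hu hu0)).1
  exact ⟨hecke_eq_slash_of_stabilizesLattice hQ hδ (stabilizesLattice_signInvolutionGL hcoord) hf hz,
    hecke_hecke_eq_self_of_stabilizesLattice hQ hδ signInvolutionGL_mul_self
      (fun x hx => vecMul_signInvolution_mem hcoord hx) hf hz⟩

omit [NumberField.IsCMField K] in
/-- `diag(−1, 1, −1)` lies outside every torsion-free subgroup and satisfies `δ⁻¹ ∈ S δ S`: it is
a non-trivial self-adjoint Hecke operator for every torsion-free `S` (e.g. the `S'` of row 141). -/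
theorem signInvolutionGL_not_mem_inv_mem_doubleCoset {S : Subgroup (GL (Fin 3) K)}
    (hS : IsTorsionFreeSet K (S : Set (GL (Fin 3) K))) :
    (signInvolutionGL : GL (Fin 3) K) ∉ S ∧
      (signInvolutionGL : GL (Fin 3) K)⁻¹ ∈ doubleCoset S signInvolutionGL :=
  ⟨not_mem_of_isTorsionFreeSet_of_mul_self_eq_one hS signInvolutionGL_mul_self signInvolutionGL_ne_one,
    inv_mem_doubleCoset_of_sq_mem (by rw [signInvolutionGL_mul_self]; exact S.one_mem)⟩

end Summit.Ventures.HodgeRepro2.ShimuraData
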